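import Summits.BirchSwinnertonDyer.BirchSwinnertonDyer.Theorems.ErratumRoadFiveNonSurjCornerTwinKatoRat
import Summits.BirchSwinnertonDyer.BirchSwinnertonDyer.Theorems.ClassRecordThreeCornerAtThreeTwinRubin

/-!
# Route `ClassRecordThree` (rung K2@3), crux 7 `CornerAtThree` (item 19111), conjunct (Tw)
# `Three.CornerTwistAt`: the Kato half of the rank-0 twin's `BSD(3)` from the PRIME-UNIFORM multiplicative
# Kato binder + Wuthrich 2014 Cor. 18 + `μ = 0` — NO Euler-unit certificate
# (cell `bsd-stepL`, seat `bsd-stepL-corner-p1` g5; `--supports stmt-BirchSwinnertonDyer-19111`)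

Item 19111 `CornerAtThree := ∀ W, Three.CornerStepLAt W ∧ Three.CornerTwistAt W ∧ Three.CornerUpperAt W`.
Conjunct (Tw) asks for `BSDp Wd 3` at every odd-`d_K` Heegner twin `Wd = Cd • E^{(d_K)}` (rank `0`) of a
non-surjective X11b pair `(E, 3)`. g4 (`Theorems/ClassRecordThreeCornerAtThreeTwinRubin.lean`, p465089)
discharged its Euler-system half BY CITATION (Rubin 1998 Thm. 8.7, `N`-imprimitive) on the EULER-UNIT locus of
the twins, modulo `μ = 0`. THIS FILE replaces the citation by the prime-uniform typed statement of the `p = 2`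
cell, `X5.O1.KatoMultiplicativeDivisibilityRat Wd 3` (`X5/TwoAdicTargetsMultKatoRat.lean`; reduced by that cell
at every odd `p` to Kato's §17.13 inputs at a multiplicative prime, `Kato2004/DivisibilityInputsMultiplicative.lean`),
through this seat's `multDivisibilityAt_of_katoMultRat_of_corollary18_of_mu_eq_zero`
(`Theorems/ErratumRoadFiveNonSurjCornerTwinKatoRat.lean`): the Euler-unit certificate disappears.

* §1 `missingUpperBoundAt_of_katoMultRat_of_corollary18_of_mu_eq_zero` — at ANY globally minimal `W` of
  analytic rank `0` with `p ≠ 2` multiplicative: the Kato half `Typed.MissingUpperBoundAt W p` from the binder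
  `KatoMultiplicativeDivisibilityRat W p` + Wuthrich 2014 Cor. 18 + `μ(X(E/ℚ_∞)) = 0` (shape) + the rank-`0`
  engine's PUBLISHED inputs (SW13 Thm. 6.1 ×2, GZK, modularity ×2, Greenberg–Stevens).
* §2 `missingUpperBoundAt_heegnerTwist_of_katoMultRat_…` — the same at the Heegner twin `Wd = Cd • E^{(d_K)}`
  of a curve multiplicative at `p` (`Wd` multiplicative at `p`, analytic rank `0`).
* §3 (`p = 3`) `bsdp_three_heegnerTwist_of_lower_of_katoMultRat_…` — `BSDp Wd 3` from §2 + the OTHER half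
  `Typed.MissingLowerBoundAt Wd 3` (shape); **`cornerTwistAt_of_lowerTwists_of_katoMultRat_of_mu_eq_zero`** —
  conjunct (Tw) of 19111 for `W` ⟸ Cor. 18 + engine pubs + [lower half at every odd Heegner twin] + [the
  binder at every such twin] + [`μ = 0` at every such twin]. Compared with p465089: no `hoff`, no certificate.

READING. On (T4″)@3 the twin summand (Tw) is now: the route's IMC side at the twin (`hlow`) + `μ = 0` at the
twin (rung K6's object at `3 ∥ N`) + the `bsd-2adic` binder at the twin (kernel ∘ Literature at odd `p` once
p474627 lands) + Cor. 18.

HONEST FRAMING. Theorems only (no `def`); `h18` is a NAMED Literature fact (p460048); `hK`, `hμ`, `hlow` are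
hypothesis SHAPES (`hK` = another cell's Summits-side `@[conjecture]` def); nothing here proves them or any pair's
`BSD(3)`; item 19111 does NOT close (conjuncts `CornerStepLAt`, `CornerUpperAt` untouched); no census word
moves; BSD is not proved by any of this.

References: [Kato2004Asterisque] Thm. 17.4 (p. 273), §17.13 (pp. 279–280); [Wuthrich2014] Cor. 18 (p. 398);
[Rubin1998Durham] Prop. A.2; [SteinWuthrich2013] Thm. 6.1; [GreenbergStevens1993]; [Miller2011LMS] Def. 1.1;
[GreenbergLNM1716] Conj. 1.11; tree: `Theorems/ErratumRoadFiveNonSurjCornerTwinKatoEngine.lean`,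
`…TwinKatoRat.lean`, `…ClassRecordThreeCornerAtThreeTwinRubin.lean`, `X5/TwoAdicTargetsMultKatoRat.lean`.
-/

noncomputable section

open scoped Classical NumberField MatrixGroups ModularForm

namespace Summit.BirchSwinnertonDyer.Rank1Residual.X11b

open CongruenceSubgroup WeierstrassCurve NumberField IsDedekindDomain Field
  Literature.NumberTheory.EllipticCurves
  Literature.NumberTheory.EllipticCurves.ModularForms
  Literature.NumberTheory.EllipticCurves.Rank1Residual
  Literature.NumberTheory.EllipticCurves.Rank1Residual.Typed
  Literature.NumberTheory.EllipticCurves.Wuthrich2014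
  Literature.NumberTheory.EllipticCurves.SteinWuthrich2013
  Summit.BirchSwinnertonDyer.Rank1Residual
  Summit.BirchSwinnertonDyer.Rank1Residual.X11b.Three
  Summit.BirchSwinnertonDyer.Rank1Residual.X5.O1

/-! ### §1 The Kato half in analytic rank `0` at an odd multiplicative prime -/

/-- **The Kato half `Typed.MissingUpperBoundAt W p` of a rank-`0` pair at an odd multiplicative prime, from the
prime-uniform binder + Cor. 18 + `μ = 0`.** Inputs: the rank-`0` engine's PUBLISHED facts (Stein–Wuthrich 2013
Thm. 6.1 split ∕ non-split `hJs`, `hJn`; GZK `hGZK`; modularity `hmod`, `hpar`; Greenberg–Stevens `hGS`);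
`hK : X5.O1.KatoMultiplicativeDivisibilityRat W p` (the `p = 2` cell's typed statement, hypothesis); Wuthrich
2014 Cor. 18 (`h18`, named fact); `μ(X(E/ℚ_∞)) = 0` for every cyclotomic dual datum (`hμ`, shape — rung K6's
object). Chain: §2 of `…TwinKatoRat.lean` gives `MultDivisibilityAt W p`; the engine
`missingUpperBoundAt_of_multDivisibilityAt_of_analyticRank_eq_zero` (p453738) gives the Kato half. NO image
hypothesis, NO (ram), NO Euler-unit certificate. CONDITIONAL on `hK`, `h18`, `hμ`; nothing booked.
[cite: SteinWuthrich2013, Thm. 6.1 (p. 20) and §4.2] [cite: Wuthrich2014, Cor. 18 (p. 398)]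
[cite: Kato2004Asterisque, Thm. 17.4 (p. 273) (shape of hK)] [cite: Miller2011LMS, Def. 1.1]
[cite: GreenbergLNM1716, §1 Conj. 1.11 (shape of μ = 0)] -/
theorem missingUpperBoundAt_of_katoMultRat_of_corollary18_of_mu_eq_zero
    (hJs : thm61_splitMultiplicative) (hJn : thm61_nonsplitMultiplicative)
    (hGZK : rank_eq_analyticRank_of_analyticRank_le_one) (hmod : hasEntireLFunction_rat)
    (hpar : nonempty_modularParametrizationData)
    (h18 : Wuthrich2014.corollary18_padicLFunction_mem_iwasawaAlgebra_multiplicative)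
    (W : WeierstrassCurve ℚ) [W.IsElliptic] [W.IsGloballyMinimal] (p : ℕ) [Fact p.Prime]
    (hGS : greenberg_stevens (W := W) (p := p))
    (hp : p ≠ 2) (hmult : W.HasMultiplicativeReductionAtPrime p) (hr : W.analyticRank = 0)
    (hK : KatoMultiplicativeDivisibilityRat W p)
    (hμ : ∀ (κ : ZpExtension ℚ p) (γ : Field.absoluteGaloisGroup ℚ),
      κ.IsCyclotomic → κ.IsTopGenerator γ → IsCyclotomicVariable p γ →
      ∀ D : W.SelmerDualData κ γ, D.mu = 0) :
    Typed.MissingUpperBoundAt W p :=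
  missingUpperBoundAt_of_multDivisibilityAt_of_analyticRank_eq_zero hJs hJn hGZK hmod hpar W p hGS hp
    hmult hr
    (multDivisibilityAt_of_katoMultRat_of_corollary18_of_mu_eq_zero h18 W p hp hmult hK hμ)

/-! ### §2 At the Heegner twin of a curve multiplicative at `p` -/

/-- **The Kato half at the rank-`0` Heegner twin `Wd = Cd • E^{(d_K)}`** of a curve `E` with `p ≠ 2`
multiplicative, `K` imaginary quadratic satisfying the Heegner hypothesis for `N_E`, `L(E^{(d_K)},1) ≠ 0`:
`Wd` is multiplicative at `p` (`hasMultiplicativeReductionAtPrime_twist_of_heegner'`) and of analytic rank `0`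
(`analyticRank_heegnerTwist_eq_zero`), so §1 applies at `(Wd, p)` with the binder and `μ = 0` read on `Wd`.
CONDITIONAL on `hK`, `hμ`; nothing booked. [cite: Wuthrich2014, Cor. 18 (p. 398)]
[cite: SilvermanAEC2009, VII.5 Prop. 5.1(b) and X.5 Cor. 5.4] [cite: Miller2011LMS, Def. 1.1] -/
theorem missingUpperBoundAt_heegnerTwist_of_katoMultRat_of_corollary18_of_mu_eq_zero
    (hJs : thm61_splitMultiplicative) (hJn : thm61_nonsplitMultiplicative)
    (hGZK : rank_eq_analyticRank_of_analyticRank_le_one) (hmod : hasEntireLFunction_rat)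
    (hpar : nonempty_modularParametrizationData)
    (hGS : ∀ (W : WeierstrassCurve ℚ) [W.IsElliptic] [W.IsGloballyMinimal] (p : ℕ) [Fact p.Prime],
      greenberg_stevens (W := W) (p := p))
    (h18 : Wuthrich2014.corollary18_padicLFunction_mem_iwasawaAlgebra_multiplicative)
    (W : WeierstrassCurve ℚ) [W.IsElliptic] (p : ℕ) [Fact p.Prime]
    (hp : p ≠ 2) (hmult : W.HasMultiplicativeReductionAtPrime p)
    (K : Type) [Field K] [NumberField K] (hK : IsImaginaryQuadratic K)
    (hHN : SatisfiesHeegnerHypothesis (W.conductorNorm ℤ) K)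
    (hLt : (W.quadraticTwist (NumberField.discr K : ℚ)).entireLFunction 1 ≠ 0)
    (Wd : WeierstrassCurve ℚ) [Wd.IsElliptic] [Wd.IsGloballyMinimal] (Cd : VariableChange ℚ)
    (hWd : Cd • W.quadraticTwist (NumberField.discr K : ℚ) = Wd)
    (hKd : KatoMultiplicativeDivisibilityRat Wd p)
    (hμ : ∀ (κ : ZpExtension ℚ p) (γ : Field.absoluteGaloisGroup ℚ),
      κ.IsCyclotomic → κ.IsTopGenerator γ → IsCyclotomicVariable p γ →
      ∀ D : Wd.SelmerDualData κ γ, D.mu = 0) :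
    Typed.MissingUpperBoundAt Wd p := by
  have hmultd : Wd.HasMultiplicativeReductionAtPrime p :=
    hasMultiplicativeReductionAtPrime_twist_of_heegner' W p K hK hHN hmult Cd hWd
  have hrd : Wd.analyticRank = 0 := analyticRank_heegnerTwist_eq_zero W K hLt Cd hWd
  exact missingUpperBoundAt_of_katoMultRat_of_corollary18_of_mu_eq_zero hJs hJn hGZK hmod hpar h18 Wd p
    (hGS Wd p) hp hmultd hrd hKd hμ

/-! ### §3 `p = 3`: conjunct (Tw) `Three.CornerTwistAt` of item 19111 -/

/-- **`BSD(E^{(d_K)}, 3)` at an odd Heegner twin of a pair `(E, 3)` with `3` multiplicative, from the Kato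
half of §2 (binder + Cor. 18 + `μ = 0`) and the OTHER half `Typed.MissingLowerBoundAt Wd 3`** (the
main-conjecture ∕ Eisenstein side at the rank-`0` twin — the route's cruxes at the twin; shape `hlow`): the two
halves give `Typed.MissingPPartAt Wd 3`, whence `BSDp Wd 3` in analytic rank `0` (`bsdp_of_missingPPartAt`,
GZK). CONDITIONAL on `hlow`, `hKd`, `hμ`; nothing booked. [cite: Wuthrich2014, Cor. 18 (p. 398)]
[cite: Miller2011LMS, §1 and Def. 1.1] -/
theorem bsdp_three_heegnerTwist_of_lower_of_katoMultRat_of_corollary18_of_mu_eq_zero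
    (hJs : thm61_splitMultiplicative) (hJn : thm61_nonsplitMultiplicative)
    (hGZK : rank_eq_analyticRank_of_analyticRank_le_one) (hmod : hasEntireLFunction_rat)
    (hpar : nonempty_modularParametrizationData)
    (hGS : ∀ (W : WeierstrassCurve ℚ) [W.IsElliptic] [W.IsGloballyMinimal] (p : ℕ) [Fact p.Prime],
      greenberg_stevens (W := W) (p := p))
    (h18 : Wuthrich2014.corollary18_padicLFunction_mem_iwasawaAlgebra_multiplicative)
    (W : WeierstrassCurve ℚ) [W.IsElliptic] (hmult : W.HasMultiplicativeReductionAtPrime 3)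
    (K : Type) [Field K] [NumberField K] (hK : IsImaginaryQuadratic K)
    (hHN : SatisfiesHeegnerHypothesis (W.conductorNorm ℤ) K)
    (hLt : (W.quadraticTwist (NumberField.discr K : ℚ)).entireLFunction 1 ≠ 0)
    (Wd : WeierstrassCurve ℚ) [Wd.IsElliptic] [Wd.IsGloballyMinimal] (Cd : VariableChange ℚ)
    (hWd : Cd • W.quadraticTwist (NumberField.discr K : ℚ) = Wd)
    (hKd : KatoMultiplicativeDivisibilityRat Wd 3)
    (hμ : ∀ (κ : ZpExtension ℚ 3) (γ : Field.absoluteGaloisGroup ℚ),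
      κ.IsCyclotomic → κ.IsTopGenerator γ → IsCyclotomicVariable 3 γ →
      ∀ D : Wd.SelmerDualData κ γ, D.mu = 0)
    (hlow : Typed.MissingLowerBoundAt Wd 3) :
    BSDp Wd 3 := by
  have hrd : Wd.analyticRank = 0 := analyticRank_heegnerTwist_eq_zero W K hLt Cd hWd
  have hup : Typed.MissingUpperBoundAt Wd 3 :=
    missingUpperBoundAt_heegnerTwist_of_katoMultRat_of_corollary18_of_mu_eq_zero hJs hJn hGZK hmod hpar hGS
      h18 W 3 (by decide) hmult K hK hHN hLt Wd Cd hWd hKd hμ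
  exact Typed.bsdp_of_missingPPartAt Wd 3 hGZK (by rw [hrd]; exact zero_le_one)
    (Typed.missingPPartAt_of_lower_of_upper Wd 3 hlow hup)

/-- **Conjunct (Tw) `Three.CornerTwistAt W` of crux 7 `CornerAtThree` (item 19111) modulo Wuthrich 2014
Cor. 18 + engine pubs + [the main-conjecture half `MissingLowerBoundAt` at every odd Heegner twin] + [the
prime-uniform Kato binder `KatoMultiplicativeDivisibilityRat Wd 3` at every such twin] + [`μ = 0` at every such
twin].** The non-surjective corner at `3` consumes `BSD(E^{(d_K)},3)` of its rank-`0` twins; this theorem splits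
that input into its two Miller halves and supplies the Euler-system half from the `bsd-2adic` binder (no image
hypothesis, no Euler-unit certificate — contrast p465089's `hoff`), leaving the twin's IMC half (`hlow`), the
binder (`hK`) and `μ = 0` (`hμ`). CONDITIONAL on `hlow`, `hK`, `hμ`; does NOT close item 19111 (conjuncts
`CornerStepLAt`, `CornerUpperAt` untouched); nothing booked. [cite: Wuthrich2014, Cor. 18 (p. 398)]
[cite: SteinWuthrich2013, Thm. 6.1 (p. 20)] [cite: Kato2004Asterisque, Thm. 17.4 (p. 273) (shape of hK)]
[cite: Miller2011LMS, §1 and Def. 1.1] [cite: GreenbergLNM1716, §1 Conj. 1.11 (shape of μ = 0)] -/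
theorem cornerTwistAt_of_lowerTwists_of_katoMultRat_of_mu_eq_zero
    (hJs : thm61_splitMultiplicative) (hJn : thm61_nonsplitMultiplicative)
    (hGZK : rank_eq_analyticRank_of_analyticRank_le_one) (hmod : hasEntireLFunction_rat)
    (hpar : nonempty_modularParametrizationData)
    (hGS : ∀ (W : WeierstrassCurve ℚ) [W.IsElliptic] [W.IsGloballyMinimal] (p : ℕ) [Fact p.Prime],
      greenberg_stevens (W := W) (p := p))
    (h18 : Wuthrich2014.corollary18_padicLFunction_mem_iwasawaAlgebra_multiplicative)
    (W : WeierstrassCurve ℚ) [W.IsElliptic] [W.IsGloballyMinimal]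
    -- the main-conjecture ∕ Eisenstein half at every odd Heegner twin (route cruxes at the twin; shape)
    (hlow : ∀ (K : Type) [Field K] [NumberField K]
      (Wd : WeierstrassCurve ℚ) [Wd.IsElliptic] [Wd.IsGloballyMinimal] (Cd : VariableChange ℚ),
      ClassX11b W 3 → ¬ Surj W 3 → IsImaginaryQuadratic K → Odd (NumberField.discr K) →
      SatisfiesHeegnerHypothesis (W.conductorNorm ℤ) K →
      (W.quadraticTwist (NumberField.discr K : ℚ)).entireLFunction 1 ≠ 0 →
      Cd • W.quadraticTwist (NumberField.discr K : ℚ) = Wd → Typed.MissingLowerBoundAt Wd 3)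
    -- the prime-uniform multiplicative Kato binder at every such twin (bsd-2adic's typed statement; shape)
    (hK : ∀ (K : Type) [Field K] [NumberField K]
      (Wd : WeierstrassCurve ℚ) [Wd.IsElliptic] [Wd.IsGloballyMinimal] (Cd : VariableChange ℚ),
      ClassX11b W 3 → ¬ Surj W 3 → IsImaginaryQuadratic K → Odd (NumberField.discr K) →
      SatisfiesHeegnerHypothesis (W.conductorNorm ℤ) K →
      (W.quadraticTwist (NumberField.discr K : ℚ)).entireLFunction 1 ≠ 0 →
      Cd • W.quadraticTwist (NumberField.discr K : ℚ) = Wd → KatoMultiplicativeDivisibilityRat Wd 3)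
    -- Greenberg's μ = 0 at every such twin (rung K6's object; shape)
    (hμ : ∀ (K : Type) [Field K] [NumberField K]
      (Wd : WeierstrassCurve ℚ) [Wd.IsElliptic] [Wd.IsGloballyMinimal] (Cd : VariableChange ℚ),
      ClassX11b W 3 → ¬ Surj W 3 → IsImaginaryQuadratic K → Odd (NumberField.discr K) →
      SatisfiesHeegnerHypothesis (W.conductorNorm ℤ) K →
      (W.quadraticTwist (NumberField.discr K : ℚ)).entireLFunction 1 ≠ 0 →
      Cd • W.quadraticTwist (NumberField.discr K : ℚ) = Wd →
      ∀ (κ : ZpExtension ℚ 3) (γ : Field.absoluteGaloisGroup ℚ),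
        κ.IsCyclotomic → κ.IsTopGenerator γ → IsCyclotomicVariable 3 γ →
        ∀ D : Wd.SelmerDualData κ γ, D.mu = 0) :
    CornerTwistAt W := by
  intro K _ _ Wd _ _ Cd hX hns hKq hodd hHN hLt hWd
  exact bsdp_three_heegnerTwist_of_lower_of_katoMultRat_of_corollary18_of_mu_eq_zero hJs hJn hGZK hmod
    hpar hGS h18 W hX.2.2.1 K hKq hHN hLt Wd Cd hWd (hK K Wd Cd hX hns hKq hodd hHN hLt hWd)
    (hμ K Wd Cd hX hns hKq hodd hHN hLt hWd) (hlow K Wd Cd hX hns hKq hodd hHN hLt hWd)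

end Summit.BirchSwinnertonDyer.Rank1Residual.X11b

end
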